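import Mathlib
import Summits.AtomisticToContinuum.Crystallization.Theses.IsometryAtoms
import Literature.Geometry.DiscreteGeometry.MultiregularPointSystems
import Summits.AtomisticToContinuum.Crystallization.Theorems.IsometryAtomsAtomicLawChargesCrystalMeasurableSetIsometryClass
import Summits.AtomisticToContinuum.Crystallization.Theorems.IsometryAtomsAtomicLawChargesCrystalStabiliserBound
import Summits.AtomisticToContinuum.Crystallization.Theorems.IsometryAtomsAtomicLawChargesCrystalSo3Toolkit
import Summits.AtomisticToContinuum.Crystallization.Theorems.IsometryAtomsAtomicLawChargesCrystalSmallPartsCommute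
import Summits.AtomisticToContinuum.Crystallization.Theorems.IsometryAtomsAtomicLawChargesCrystalPeriodicOfFinitePointGroup
import Summits.AtomisticToContinuum.Crystallization.Theorems.IsometryAtomsAtomicLawChargesCrystalFinitePointGroup
import Summits.AtomisticToContinuum.Crystallization.Theorems.IsometryAtomsAtomicLawChargesCrystalFiniteOrbitsOfChargedClass

/-!
# The bridge `IsometryAtoms.AtomicLawChargesCrystal` (stmt-AtomisticToContinuum-15778), proved — line `Sketch`
# (inverse-stabiliser law ∘ coaxial collapse)

Route `route-AtomisticToContinuum-IsometryAtoms`, sub-problem `Crystallization`; this is the lead prover's registered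
skeleton `Cruxes/AtomicLawChargesCrystal/Lines/Sketch.lean` with its seven stubs discharged by the landed files
`Theorems/IsometryAtomsAtomicLawChargesCrystal*.lean` (closing theorem `atomicLawChargesCrystal_proof`).

The crux (FIXED — the route's decl, never restated): a probability law `P` on rooted configurations of `ℝ³`,
a.s. `δ`-hard-core, point-stationary (Mecke identity), a.s. relatively dense, with an atom modulo isometry at `Y`,
charges every `(R, ε)`-window of ONE `Q : PeriodicConfiguration 3` (in fact `Q.points = Y`).

## The line

It composes the two crux ideas `inverse-stabiliser-law` (Palm half) and `coaxial-collapse` (geometric half):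
compared with the registered lines `birth` / `so3_commutator`, the Palm half delivers the STRONGER output
"finitely many symmetry orbits" (detailed two-event Mecke balance `m(a)·n_ab(r) = m(b)·n_ba(r)` times the
inversion symmetry `n_ab·|Stab b| = n_ba·|Stab a|`, so `m(b)·|Stab b| = m(a)·|Stab a|` for every orbit `b`, and a
uniform stabiliser bound makes the orbit set finite), which makes the geometric half SOFT (cocompactness instead
of cubic growth: no `O(r)` / `O(r²)` / `O(r³)` counts, no Voronoi cells, no named fact):

* `isometryAtoms_deloneOfRealisedClass` (PROVED here, = birth/so3 stub 1): a realised hard-core relatively dense copy makes `Y`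
  a `Delone.DeloneSet`.
* S2 `stub_measurableSet_isometryClass` (VERBATIM birth/so3 stub 2): Giry measurability of a rooted isometry class.
* SB `stub_stabiliserBound`: (i) an affine isometry fixing pointwise the patch `D ∩ B̄(x, 20 R_c)` of a Delone set
  is the identity (the patch contains an affine frame); (ii) hence point stabilisers in `Sym(D)` are finite of
  uniformly bounded order (they act faithfully on a patch of uniformly bounded cardinality).
* S3' `stub_finiteOrbitsOfChargedClass` (THE PALM LEVER, lead's stub): point-stationary `P`, a.s. rooted
  hard-core, charging the atom event of a Delone `D` (classes measurable, stabilisers uniformly bounded) ⇒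
  `HasFinitelyManySymmetryOrbits D`.  Mecke with the two-event transport
  `g(μ,y) = 1_{C_a}(μ)·1_{C_b}(θ_y κμ)·1{‖y‖ ≤ r}` (`κ` the s-finite identity kernel on locally finite
  configurations, `Literature.Probability.Process.exists_isSFiniteKernel_apply_eq_self`).
* TK `stub_so3Toolkit`: five facts on linear isometries of `ℝ³` (accumulation in an infinite set of them; a
  near-identity one fixes a unit vector; its fixed space is that line; two near-identity ones with a common fixed
  unit vector commute; `A - 1` is onto `u^⊥` for a near-identity `A ≠ 1` with axis `u`).
* G1a `stub_smallPartsCommute` (Bieberbach's lemma, conclusion VERBATIM so3's G1a; hypotheses: SB(i), TK):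
  small linear parts of symmetries of a Delone set commute (commutator contraction + discreteness).
* FPG `stub_finitePointGroup` (coaxial collapse; hypotheses TK, G1a-conclusion): a Delone set with finitely many
  symmetry orbits has a finite point group `{g.linear : g ∈ Sym D}` (else small rotations accumulate, all about
  one axis `u` by G1a; translations lie on `ℝu`; the generator `g₀` commutes with all its conjugates, so its axis
  line is `Sym(D)`-invariant — contradicting cocompactness).
* LFP `stub_periodicOfFinitePointGroup`: finitely many orbits + finite point group ⇒ the translation vectors form
  a full lattice `L` (cosets of `T` are finitely many, cocompactness forces `span T = ℝ³`, uniform discreteness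
  gives `DiscreteTopology`) and `D = Q.points` for the `PeriodicConfiguration` with lattice `L` and motif
  `D ∩ (fundamental domain)`.

Composition (sorry-free, below): extraction of a realised copy (`Measure.exists_mem_of_measure_ne_zero_of_ae`) →
Delone → SB → S3' (with S2) → TK → G1a → FPG → LFP → windows (the atom event lies in every matching event).

Disproof / negatives honoured: `Negative.FalseWithoutRelDense` (relative density is consumed: Delone covering
radius in SB's frame, cocompactness in FPG/LFP); `Negative.LatticeLaw.frame_inhabited` (`ℤ³`: one orbit,
`|Stab| = 48`, point group `O_h` finite, `T = ℤ³`) consistent with every stub.  No `Disproof.lean` published yet.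
-/

noncomputable section

namespace Summit.AtomisticToContinuum.Crystallization.Theorems

open MeasureTheory Metric

/-- The crux through its constant (definitional unfolding, for the reader). -/
theorem isometryAtomsAtomicLawChargesCrystal_iff :
    Summit.AtomisticToContinuum.Crystallization.Theses.IsometryAtoms.AtomicLawChargesCrystal ↔
      (∀ δ : ℝ, 0 < δ → ∀ P : MeasureTheory.Measure (MeasureTheory.Measure (EuclideanSpace ℝ (Fin 3))), MeasureTheory.IsProbabilityMeasure P → (∀ᵐ μ ∂P, Literature.Probability.Process.IsRootedHardCore δ μ) → Literature.Probability.Process.IsPointStationaryLaw P → (∀ᵐ μ ∂P, ∃ R₀ : ℝ, ∀ z : EuclideanSpace ℝ (Fin 3), ∃ y : EuclideanSpace ℝ (Fin 3), μ {y} ≠ 0 ∧ dist z y ≤ R₀) → (∃ Y : Set (EuclideanSpace ℝ (Fin 3)), 0 < P {μ | ∃ A : EuclideanSpace ℝ (Fin 3) →ₗᵢ[ℝ] EuclideanSpace ℝ (Fin 3), ∃ q ∈ Y, μ = (MeasureTheory.Measure.count : MeasureTheory.Measure (EuclideanSpace ℝ (Fin 3))).restrict ((fun s => A (s - q)) ''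 Y)}) → ∃ Q : Literature.MathematicalPhysics.StatisticalMechanics.PeriodicConfiguration 3, ∀ R ε : ℝ, 0 < R → 0 < ε → 0 < P {μ | ∃ A : EuclideanSpace ℝ (Fin 3) →ₗᵢ[ℝ] EuclideanSpace ℝ (Fin 3), ∃ q ∈ Q.points, (∀ s ∈ Q.points, dist s q ≤ R → ∃ y : EuclideanSpace ℝ (Fin 3), μ {y} ≠ 0 ∧ dist y (A (s - q)) ≤ ε) ∧ (∀ y : EuclideanSpace ℝ (Fin 3), μ {y} ≠ 0 → ‖y‖ ≤ R → ∃ s ∈ Q.points, dist y (A (s - q)) ≤ ε)}) :=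
  Iff.rfl

/-! ## Step B, proved: a realised hard-core relatively dense copy makes `Y` Delone (= birth/so3 stub 1) -/

/-- **A realised hard-core, relatively dense copy makes `Y` Delone** (the statement of birth/so3 stub 1, proved):
if `count|((fun s => A (s - q)) '' Y)` is a rooted `δ`-hard-core configuration (`δ > 0`) and relatively dense,
then `Y` carries a `Delone.DeloneSet` structure (packing radius `δ/2`, covering radius `max R₀ 1`): the carrier of
the counting measure is recovered by `count_restrict_singleton_ne_zero_iff`, and separation / covering pull back
along the isometry `s ↦ A (s - q)`. -/
theorem isometryAtoms_deloneOfRealisedClass : ∀ δ : ℝ, 0 < δ → ∀ (Y : Set (EuclideanSpace ℝ (Fin 3))) (A : EuclideanSpace ℝ (Fin 3) →ₗᵢ[ℝ] EuclideanSpace ℝ (Fin 3)) (q : EuclideanSpace ℝ (Fin 3)), Literature.Probability.Process.IsRootedHardCore δ ((MeasureTheory.Measure.count : MeasureTheory.Measure (EuclideanSpace ℝ (Fin 3))).restrict ((fun s => A (s - q)) '' Y)) → (∃ R₀ : ℝ, ∀ z : EuclideanSpace ℝ (Fin 3), ∃ y : EuclideanSpace ℝ (Fin 3), ((MeasureTheory.Measure.count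 : MeasureTheory.Measure (EuclideanSpace ℝ (Fin 3))).restrict ((fun s => A (s - q)) '' Y)) {y} ≠ 0 ∧ dist z y ≤ R₀) → ∃ D : Delone.DeloneSet (EuclideanSpace ℝ (Fin 3)), (D : Set (EuclideanSpace ℝ (Fin 3))) = Y := by
  intro δ hδ Y A q hHC hRD
  obtain ⟨S, -, hsep, hS⟩ := hHC
  obtain ⟨R₀, hR₀⟩ := hRD
  -- the carrier of the counting measure is the image set
  have himg : ∀ y, y ∈ (fun s => A (s - q)) '' Y ↔ y ∈ S := fun y => by
    rw [← Literature.Probability.Process.count_restrict_singleton_ne_zero_iff ((fun s => A (s - q)) '' Y) y,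
      hS, Literature.Probability.Process.count_restrict_singleton_ne_zero_iff]
  -- separation pulls back
  have hsepY : ∀ x ∈ Y, ∀ y ∈ Y, x ≠ y → δ ≤ dist x y := by
    intro x hx y hy hxy
    have hx' : A (x - q) ∈ S := (himg _).1 ⟨x, hx, rfl⟩
    have hy' : A (y - q) ∈ S := (himg _).1 ⟨y, hy, rfl⟩
    have hne : A (x - q) ≠ A (y - q) := fun h => hxy (by simpa using A.injective h)
    have := hsep _ hx' _ hy' hne
    rwa [A.dist_map, dist_sub_right] at this
  -- covering pulls back
  have hcovY : ∀ z : (EuclideanSpace ℝ (Fin 3)), ∃ y ∈ Y, dist z y ≤ max R₀ 1 := by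
    intro z
    obtain ⟨y, hy, hzy⟩ := hR₀ (A (z - q))
    rw [Literature.Probability.Process.count_restrict_singleton_ne_zero_iff] at hy
    obtain ⟨s, hs, rfl⟩ := hy
    refine ⟨s, hs, ?_⟩
    rw [A.dist_map, dist_sub_right] at hzy
    exact hzy.trans (le_max_left _ _)
  refine ⟨{ carrier := Y, packingRadius := (δ / 2).toNNReal, packingRadius_pos := Real.toNNReal_pos.mpr (by positivity), isSeparated_packingRadius := ?_, coveringRadius := (max R₀ 1).toNNReal, coveringRadius_pos := Real.toNNReal_pos.mpr (by positivity), isCover_coveringRadius := ?_ }, rfl⟩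
  · intro x hx y hy hxy
    have h := hsepY x hx y hy hxy
    show ENNReal.ofReal (δ / 2) < edist x y
    rw [edist_dist]
    exact (ENNReal.ofReal_lt_ofReal_iff (dist_pos.2 hxy)).2 (by linarith)
  · rw [Metric.isCover_iff_subset_iUnion_closedBall]
    intro z _
    obtain ⟨y, hy, hzy⟩ := hcovY z
    refine Set.mem_iUnion₂.2 ⟨y, hy, Metric.mem_closedBall.2 ?_⟩
    rw [Real.coe_toNNReal _ (by positivity)]
    exact hzy

/-! ## Composition (sorry-free) -/

/-- **Composition with explicit hypotheses** (sorry-free): the seven stubs' STATEMENTS, verbatim, imply the BODY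
of the crux (`AtomicLawChargesCrystal` unfolded — see `isometryAtomsAtomicLawChargesCrystal_iff`).  Steps proved here: (A) extraction of one
realised hard-core, relatively dense copy of `Y` from the positive-measure atom event and the two a.s. clauses;
(B) `isometryAtoms_deloneOfRealisedClass`; (C) SB + S2 + S3' ⇒ finitely many orbits; (D) TK + G1a + FPG ⇒ finite point group,
LFP ⇒ `Q.points = Y`; (E) the atom event is contained in every `(R, ε)`-matching event of `Q`. -/
theorem isometryAtomsAtomicLawChargesCrystal_of_stubs :
    (∀ (D : Delone.DeloneSet (EuclideanSpace ℝ (Fin 3))) (q : EuclideanSpace ℝ (Fin 3)), MeasurableSet {μ : MeasureTheory.Measure (EuclideanSpace ℝ (Fin 3)) | ∃ A : EuclideanSpace ℝ (Fin 3) →ₗᵢ[ℝ] EuclideanSpace ℝ (Fin 3), μ = (MeasureTheory.Measure.count : MeasureTheory.Measure (EuclideanSpace ℝ (Fin 3))).restrict ((fun s => A (s - q)) '' (D : Set (EuclideanSpace ℝ (Fin 3))))}) →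
    ((∀ (D : Delone.DeloneSet (EuclideanSpace ℝ (Fin 3))) (g : EuclideanSpace ℝ (Fin 3) ≃ᵃⁱ[ℝ] EuclideanSpace ℝ (Fin 3)), ∀ x ∈ (D : Set (EuclideanSpace ℝ (Fin 3))), (∀ p ∈ (D : Set (EuclideanSpace ℝ (Fin 3))), dist p x ≤ 20 * (D.coveringRadius : ℝ) → g p = p) → ∀ y : EuclideanSpace ℝ (Fin 3), g y = y) ∧
      (∀ D : Delone.DeloneSet (EuclideanSpace ℝ (Fin 3)), ∃ N : ℕ, ∀ x ∈ (D : Set (EuclideanSpace ℝ (Fin 3))), {g : EuclideanSpace ℝ (Fin 3) ≃ᵃⁱ[ℝ] EuclideanSpace ℝ (Fin 3) | g '' (D : Set (EuclideanSpace ℝ (Fin 3))) = (D : Set (EuclideanSpace ℝ (Fin 3))) ∧ g x = x}.encard ≤ N)) →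
    (∀ δ : ℝ, 0 < δ → ∀ P : MeasureTheory.Measure (MeasureTheory.Measure (EuclideanSpace ℝ (Fin 3))), MeasureTheory.IsProbabilityMeasure P → (∀ᵐ μ ∂P, Literature.Probability.Process.IsRootedHardCore δ μ) → Literature.Probability.Process.IsPointStationaryLaw P → ∀ D : Delone.DeloneSet (EuclideanSpace ℝ (Fin 3)), (∀ q : EuclideanSpace ℝ (Fin 3), MeasurableSet {μ : MeasureTheory.Measure (EuclideanSpace ℝ (Fin 3)) | ∃ A : EuclideanSpace ℝ (Fin 3) →ₗᵢ[ℝ] EuclideanSpace ℝ (Fin 3), μ = (MeasureTheory.Measure.count : MeasureTheory.Measure (EuclideanSpace ℝ (Fin 3))).restrict ((fun s => A (s - q)) '' (D : Set (EuclideanSpace ℝ (Fin 3))))}) → 0 < P {μ | ∃ A : EuclideanSpace ℝ (Fin 3) →ₗᵢ[ℝ] EuclideanSpace ℝ (Fin 3), ∃ q ∈ (D : Set (EuclideanSpace ℝ (Fin 3))), μ = (MeasureTheory.Measure.count : MeasureTheory.Measure (EuclideanSpace ℝ (Fin 3))).restrict ((fun s => A (s - q)) '' (D : Set (EuclideanSpace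 ℝ (Fin 3))))} → (∃ N : ℕ, ∀ x ∈ (D : Set (EuclideanSpace ℝ (Fin 3))), {g : EuclideanSpace ℝ (Fin 3) ≃ᵃⁱ[ℝ] EuclideanSpace ℝ (Fin 3) | g '' (D : Set (EuclideanSpace ℝ (Fin 3))) = (D : Set (EuclideanSpace ℝ (Fin 3))) ∧ g x = x}.encard ≤ N) → Literature.Geometry.DiscreteGeometry.HasFinitelyManySymmetryOrbits (D : Set (EuclideanSpace ℝ (Fin 3)))) →
    ((∀ S : Set (EuclideanSpace ℝ (Fin 3) ≃ₗᵢ[ℝ] EuclideanSpace ℝ (Fin 3)), S.Infinite → ∀ ε : ℝ, 0 < ε → ∃ A ∈ S, ∃ B ∈ S, A ≠ B ∧ ∀ x : EuclideanSpace ℝ (Fin 3), ‖A x - B x‖ ≤ ε * ‖x‖) ∧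
      (∀ A : EuclideanSpace ℝ (Fin 3) ≃ₗᵢ[ℝ] EuclideanSpace ℝ (Fin 3), (∀ x : EuclideanSpace ℝ (Fin 3), ‖A x - x‖ ≤ ‖x‖ / 2) → ∃ u : EuclideanSpace ℝ (Fin 3), ‖u‖ = 1 ∧ A u = u) ∧
      (∀ A : EuclideanSpace ℝ (Fin 3) ≃ₗᵢ[ℝ] EuclideanSpace ℝ (Fin 3), (∀ x : EuclideanSpace ℝ (Fin 3), ‖A x - x‖ ≤ ‖x‖ / 2) → ∀ u : EuclideanSpace ℝ (Fin 3), ‖u‖ = 1 → A u = u → (∃ x : EuclideanSpace ℝ (Fin 3), A x ≠ x) → ∀ v : EuclideanSpace ℝ (Fin 3), A v = v → ∃ c : ℝ, v = c • u) ∧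
      (∀ A B : EuclideanSpace ℝ (Fin 3) ≃ₗᵢ[ℝ] EuclideanSpace ℝ (Fin 3), (∀ x : EuclideanSpace ℝ (Fin 3), ‖A x - x‖ ≤ ‖x‖ / 2) → (∀ x : EuclideanSpace ℝ (Fin 3), ‖B x - x‖ ≤ ‖x‖ / 2) → ∀ u : EuclideanSpace ℝ (Fin 3), ‖u‖ = 1 → A u = u → B u = u → ∀ x : EuclideanSpace ℝ (Fin 3), A (B x) = B (A x)) ∧
      (∀ A : EuclideanSpace ℝ (Fin 3) ≃ₗᵢ[ℝ] EuclideanSpace ℝ (Fin 3), (∀ x : EuclideanSpace ℝ (Fin 3), ‖A x - x‖ ≤ ‖x‖ / 2) → ∀ u : EuclideanSpace ℝ (Fin 3), ‖u‖ = 1 → A u = u → (∃ x : EuclideanSpace ℝ (Fin 3), A x ≠ x) → ∀ w : EuclideanSpace ℝ (Fin 3), inner ℝ w u = 0 → ∃ c : EuclideanSpace ℝ (Fin 3), inner ℝ c u = 0 ∧ A c - c = w)) →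
    ((∀ (D : Delone.DeloneSet (EuclideanSpace ℝ (Fin 3))) (g : EuclideanSpace ℝ (Fin 3) ≃ᵃⁱ[ℝ] EuclideanSpace ℝ (Fin 3)), ∀ x ∈ (D : Set (EuclideanSpace ℝ (Fin 3))), (∀ p ∈ (D : Set (EuclideanSpace ℝ (Fin 3))), dist p x ≤ 20 * (D.coveringRadius : ℝ) → g p = p) → ∀ y : EuclideanSpace ℝ (Fin 3), g y = y) →
      (∀ A : EuclideanSpace ℝ (Fin 3) ≃ₗᵢ[ℝ] EuclideanSpace ℝ (Fin 3), (∀ x : EuclideanSpace ℝ (Fin 3), ‖A x - x‖ ≤ ‖x‖ / 2) → ∃ u : EuclideanSpace ℝ (Fin 3), ‖u‖ = 1 ∧ A u = u) →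
      (∀ A : EuclideanSpace ℝ (Fin 3) ≃ₗᵢ[ℝ] EuclideanSpace ℝ (Fin 3), (∀ x : EuclideanSpace ℝ (Fin 3), ‖A x - x‖ ≤ ‖x‖ / 2) → ∀ u : EuclideanSpace ℝ (Fin 3), ‖u‖ = 1 → A u = u → (∃ x : EuclideanSpace ℝ (Fin 3), A x ≠ x) → ∀ v : EuclideanSpace ℝ (Fin 3), A v = v → ∃ c : ℝ, v = c • u) →
      (∀ A B : EuclideanSpace ℝ (Fin 3) ≃ₗᵢ[ℝ] EuclideanSpace ℝ (Fin 3), (∀ x : EuclideanSpace ℝ (Fin 3), ‖A x - x‖ ≤ ‖x‖ / 2) → (∀ x : EuclideanSpace ℝ (Fin 3), ‖B x - x‖ ≤ ‖x‖ / 2) → ∀ u : EuclideanSpace ℝ (Fin 3), ‖u‖ = 1 → A u = u → B u = u → ∀ x : EuclideanSpace ℝ (Fin 3), A (B x) = B (A x)) →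
      ∀ D : Delone.DeloneSet (EuclideanSpace ℝ (Fin 3)), ∀ g₁ g₂ : EuclideanSpace ℝ (Fin 3) ≃ᵃⁱ[ℝ] EuclideanSpace ℝ (Fin 3), g₁ '' (D : Set (EuclideanSpace ℝ (Fin 3))) = (D : Set (EuclideanSpace ℝ (Fin 3))) → g₂ '' (D : Set (EuclideanSpace ℝ (Fin 3))) = (D : Set (EuclideanSpace ℝ (Fin 3))) → (∀ x : EuclideanSpace ℝ (Fin 3), ‖g₁.linear x - x‖ ≤ ‖x‖ / 10) → (∀ x : EuclideanSpace ℝ (Fin 3), ‖g₂.linear x - x‖ ≤ ‖x‖ / 10) → ∀ x : EuclideanSpace ℝ (Fin 3), g₁.linear (g₂.linear x) = g₂.linear (g₁.linear x)) →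
    ((∀ S : Set (EuclideanSpace ℝ (Fin 3) ≃ₗᵢ[ℝ] EuclideanSpace ℝ (Fin 3)), S.Infinite → ∀ ε : ℝ, 0 < ε → ∃ A ∈ S, ∃ B ∈ S, A ≠ B ∧ ∀ x : EuclideanSpace ℝ (Fin 3), ‖A x - B x‖ ≤ ε * ‖x‖) →
      (∀ A : EuclideanSpace ℝ (Fin 3) ≃ₗᵢ[ℝ] EuclideanSpace ℝ (Fin 3), (∀ x : EuclideanSpace ℝ (Fin 3), ‖A x - x‖ ≤ ‖x‖ / 2) → ∃ u : EuclideanSpace ℝ (Fin 3), ‖u‖ = 1 ∧ A u = u) →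
      (∀ A : EuclideanSpace ℝ (Fin 3) ≃ₗᵢ[ℝ] EuclideanSpace ℝ (Fin 3), (∀ x : EuclideanSpace ℝ (Fin 3), ‖A x - x‖ ≤ ‖x‖ / 2) → ∀ u : EuclideanSpace ℝ (Fin 3), ‖u‖ = 1 → A u = u → (∃ x : EuclideanSpace ℝ (Fin 3), A x ≠ x) → ∀ v : EuclideanSpace ℝ (Fin 3), A v = v → ∃ c : ℝ, v = c • u) →
      (∀ A : EuclideanSpace ℝ (Fin 3) ≃ₗᵢ[ℝ] EuclideanSpace ℝ (Fin 3), (∀ x : EuclideanSpace ℝ (Fin 3), ‖A x - x‖ ≤ ‖x‖ / 2) → ∀ u : EuclideanSpace ℝ (Fin 3), ‖u‖ = 1 → A u = u → (∃ x : EuclideanSpace ℝ (Fin 3), A x ≠ x) → ∀ w : EuclideanSpace ℝ (Fin 3), inner ℝ w u = 0 → ∃ c : EuclideanSpace ℝ (Fin 3), inner ℝ c u = 0 ∧ A c - c = w) →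
      (∀ D : Delone.DeloneSet (EuclideanSpace ℝ (Fin 3)), ∀ g₁ g₂ : EuclideanSpace ℝ (Fin 3) ≃ᵃⁱ[ℝ] EuclideanSpace ℝ (Fin 3), g₁ '' (D : Set (EuclideanSpace ℝ (Fin 3))) = (D : Set (EuclideanSpace ℝ (Fin 3))) → g₂ '' (D : Set (EuclideanSpace ℝ (Fin 3))) = (D : Set (EuclideanSpace ℝ (Fin 3))) → (∀ x : EuclideanSpace ℝ (Fin 3), ‖g₁.linear x - x‖ ≤ ‖x‖ / 10) → (∀ x : EuclideanSpace ℝ (Fin 3), ‖g₂.linear x - x‖ ≤ ‖x‖ / 10) → ∀ x : EuclideanSpace ℝ (Fin 3), g₁.linear (g₂.linear x) = g₂.linear (g₁.linear x)) →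
      ∀ D : Delone.DeloneSet (EuclideanSpace ℝ (Fin 3)), Literature.Geometry.DiscreteGeometry.HasFinitelyManySymmetryOrbits (D : Set (EuclideanSpace ℝ (Fin 3))) → {A : EuclideanSpace ℝ (Fin 3) ≃ₗᵢ[ℝ] EuclideanSpace ℝ (Fin 3) | ∃ g : EuclideanSpace ℝ (Fin 3) ≃ᵃⁱ[ℝ] EuclideanSpace ℝ (Fin 3), g '' (D : Set (EuclideanSpace ℝ (Fin 3))) = (D : Set (EuclideanSpace ℝ (Fin 3))) ∧ g.linearIsometryEquiv = A}.Finite) →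
    (∀ D : Delone.DeloneSet (EuclideanSpace ℝ (Fin 3)), Literature.Geometry.DiscreteGeometry.HasFinitelyManySymmetryOrbits (D : Set (EuclideanSpace ℝ (Fin 3))) → {A : EuclideanSpace ℝ (Fin 3) ≃ₗᵢ[ℝ] EuclideanSpace ℝ (Fin 3) | ∃ g : EuclideanSpace ℝ (Fin 3) ≃ᵃⁱ[ℝ] EuclideanSpace ℝ (Fin 3), g '' (D : Set (EuclideanSpace ℝ (Fin 3))) = (D : Set (EuclideanSpace ℝ (Fin 3))) ∧ g.linearIsometryEquiv = A}.Finite → ∃ Q : Literature.MathematicalPhysics.StatisticalMechanics.PeriodicConfiguration 3, Q.points = (D : Set (EuclideanSpace ℝ (Fin 3)))) →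
    (∀ δ : ℝ, 0 < δ → ∀ P : MeasureTheory.Measure (MeasureTheory.Measure (EuclideanSpace ℝ (Fin 3))), MeasureTheory.IsProbabilityMeasure P → (∀ᵐ μ ∂P, Literature.Probability.Process.IsRootedHardCore δ μ) → Literature.Probability.Process.IsPointStationaryLaw P → (∀ᵐ μ ∂P, ∃ R₀ : ℝ, ∀ z : EuclideanSpace ℝ (Fin 3), ∃ y : EuclideanSpace ℝ (Fin 3), μ {y} ≠ 0 ∧ dist z y ≤ R₀) → (∃ Y : Set (EuclideanSpace ℝ (Fin 3)), 0 < P {μ | ∃ A : EuclideanSpace ℝ (Fin 3) →ₗᵢ[ℝ] EuclideanSpace ℝ (Fin 3), ∃ q ∈ Y, μ = (MeasureTheory.Measure.count : MeasureTheory.Measure (EuclideanSpace ℝ (Fin 3))).restrict ((fun s => A (s - q)) '' Y)}) → ∃ Q : Literature.MathematicalPhysics.StatisticalMechanics.PeriodicConfiguration 3, ∀ R ε : ℝ, 0 < R → 0 < ε → 0 < P {μ | ∃ A : EuclideanSpace ℝ (Fin 3) →ₗᵢ[ℝ] EuclideanSpace ℝ (Fin 3), ∃ q ∈ Q.points, (∀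 s ∈ Q.points, dist s q ≤ R → ∃ y : EuclideanSpace ℝ (Fin 3), μ {y} ≠ 0 ∧ dist y (A (s - q)) ≤ ε) ∧ (∀ y : EuclideanSpace ℝ (Fin 3), μ {y} ≠ 0 → ‖y‖ ≤ R → ∃ s ∈ Q.points, dist y (A (s - q)) ≤ ε)}) := by
  intro h2 hSB h3 hTK hG1a hFPG hLFP δ hδ P hP hHC hSt hRD hAtom
  obtain ⟨Y, hY⟩ := hAtom
  -- (A) EXTRACTION: the atom event has positive measure, the hard-core and relative-density clauses hold
  -- a.s., so one configuration in the atom event satisfies both.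
  obtain ⟨μ, ⟨A, q, hq, rfl⟩, hμhc, hμrd⟩ :=
    MeasureTheory.Measure.exists_mem_of_measure_ne_zero_of_ae hY.ne'
      (MeasureTheory.ae_restrict_of_ae (hHC.and hRD))
  -- (B) `Y` is a Delone set.
  obtain ⟨D, hDY⟩ := isometryAtoms_deloneOfRealisedClass δ hδ Y A q hμhc hμrd
  subst hDY
  -- (C) SB (stabiliser bound) + S2 (measurability) + S3' (mass transport): finitely many symmetry orbits.
  obtain ⟨hASL, hStab⟩ := hSB
  have hfin := h3 δ hδ P hP hHC hSt D (h2 D) hY (hStab D)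
  -- (D) TK + G1a + FPG: finite point group; LFP: `Y = Q.points` for a periodic configuration `Q`.
  obtain ⟨hT0, hT1, hT2, hT5, hT7⟩ := hTK
  have hcomm := hG1a hASL hT1 hT2 hT5
  have hPi := hFPG hT0 hT1 hT2 hT7 hcomm D hfin
  obtain ⟨Q, hQ⟩ := hLFP D hfin hPi
  -- (E) WINDOWS: the atom event lies inside every matching event of `Q`.
  refine ⟨Q, fun R ε hR hε => lt_of_lt_of_le hY (MeasureTheory.measure_mono ?_)⟩
  rintro μ ⟨A', q', hq', rfl⟩
  refine ⟨A', q', ?_, ?_, ?_⟩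
  · rw [hQ]; exact hq'
  · intro s hs _
    refine ⟨A' (s - q'), ?_, (dist_self _).trans_le hε.le⟩
    rw [Literature.Probability.Process.count_restrict_singleton_ne_zero_iff]
    exact ⟨s, hQ ▸ hs, rfl⟩
  · intro y hy _
    rw [Literature.Probability.Process.count_restrict_singleton_ne_zero_iff] at hy
    obtain ⟨s, hs, rfl⟩ := hy
    refine ⟨s, ?_, (dist_self _).trans_le hε.le⟩
    rw [hQ]; exact hs

/-- **The bridge `IsometryAtoms.AtomicLawChargesCrystal` (item stmt-AtomisticToContinuum-15778), proved.**
A probability law on rooted configurations of `ℝ³` that is a.s. `δ`-hard-core, point-stationary (Mecke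
identity), a.s. relatively dense and charges the rooted isometry class of one set `Y` charges every
`(R, ε)`-window of ONE periodic configuration `Q` (indeed `Q.points = Y`).  Assembled from the seven landed
stubs of line `Sketch`: Giry measurability of rooted isometry classes (`stub_measurableSet_isometryClass`),
affine frames / uniformly finite stabilisers (`stub_stabiliserBound`), the Palm lever — detailed Mecke
balance + inversion symmetry ⇒ finitely many symmetry orbits (`stub_finiteOrbitsOfChargedClass`), the SO(3)
toolkit (`stub_so3Toolkit`), Bieberbach's lemma (`stub_smallPartsCommute`), the coaxial collapse ⇒ finite
point group (`stub_finitePointGroup`), and lattice + packaging (`stub_periodicOfFinitePointGroup`).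
[cite: AldousLyons2007, Thm 3.1; HevelingLast2005; LastPenrose2017, §9.3; DolbilinLagariasSenechal1998,
Thm 1.1; GrahamGrotschelLovasz1996, ch. 19 Thm 5.1] -/
theorem atomicLawChargesCrystal_proof :
    Summit.AtomisticToContinuum.Crystallization.Theses.IsometryAtoms.AtomicLawChargesCrystal :=
  isometryAtomsAtomicLawChargesCrystal_iff.mpr
    (isometryAtomsAtomicLawChargesCrystal_of_stubs
      Summit.AtomisticToContinuum.Crystallization.Theorems.IsometryAtomsAtomicLawChargesCrystal.stub_measurableSet_isometryClass
      Summit.AtomisticToContinuum.Crystallization.Theorems.IsometryAtomsAtomicLawChargesCrystal.stub_stabiliserBound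
      Summit.AtomisticToContinuum.Crystallization.Theorems.IsometryAtomsAtomicLawChargesCrystal.stub_finiteOrbitsOfChargedClass
      Summit.AtomisticToContinuum.Crystallization.Theorems.IsometryAtomsAtomicLawChargesCrystal.stub_so3Toolkit
      Summit.AtomisticToContinuum.Crystallization.Theorems.IsometryAtomsAtomicLawChargesCrystal.stub_smallPartsCommute
      Summit.AtomisticToContinuum.Crystallization.Theorems.IsometryAtomsAtomicLawChargesCrystal.stub_finitePointGroup
      Summit.AtomisticToContinuum.Crystallization.Theorems.IsometryAtomsAtomicLawChargesCrystal.stub_periodicOfFinitePointGroup)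

end Summit.AtomisticToContinuum.Crystallization.Theorems

end
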